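import HarnessLib
import Summits.CriticalPhenomena.Ising3DConformalLimit.Theorems.HarmonicMomentsIsotropyTwoPointAsymptoticIsotropyOfPowerLaw
import Summits.CriticalPhenomena.Ising3DConformalLimit.Theorems.HarmonicMomentsIsotropyTwoPointAsymptoticIsotropyPairKernel
import Summits.CriticalPhenomena.Ising3DConformalLimit.Theorems.HarmonicMomentsIsotropyTwoPointAsymptoticIsotropyPairScale
import Summits.CriticalPhenomena.Ising3DConformalLimit.Theorems.HarmonicMomentsIsotropyTwoPointAsymptoticIsotropyPairWindow
import Summits.CriticalPhenomena.Ising3DConformalLimit.Theorems.HyperoctahedralRPHRP2Rigidity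
import Summits.CriticalPhenomena.Ising3DConformalLimit.Theses.HarmonicMomentsIsotropy
import Summits.CriticalPhenomena.Ising3DConformalLimit.Theses.IsingEuclidUpgrade

/-!
# Vague asymptotic isotropy of the critical `ℤ³` two-point function, XIV:
# EXISTENCE OF THE TWO-POINT SCALING LIMIT SUFFICES
(route HarmonicMomentsIsotropy, support item stmt-CriticalPhenomena-6036 `TwoPointAsymptoticIsotropy`;
main file of the pair-only conditional line)

**Theorem** (`twoPointAsymptoticIsotropy_of_pairLimit`). Suppose the critical two-point function of the
nearest-neighbour Ising model on `ℤ³` has a scaling limit in the weakest natural sense: for SOME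
renormalisation `ρ > 0` on `(0,1]` the rescaled pair correlator `ρ(δ)²⟨σ_{[a/δ]}σ_{[b/δ]}⟩_{β_c}`
converges, as `δ → 0⁺`, locally uniformly on `{a ≠ b}` to a function `S₂ > 0` there. Then
`⟨σ₀σ_x⟩_{β_c}` is asymptotically `O(3)`-invariant in the vague sense (`TwoPointAsymptoticIsotropy`): for
every continuous compactly supported `φ ≥ 0`, `φ ≢ 0`, on `ℝ³` and every `R ∈ O(3)`,
`Σ_x φ(Rx/L)⟨σ₀σ_x⟩_{β_c} / Σ_x φ(x/L)⟨σ₀σ_x⟩_{β_c} → 1` as `L → ∞`.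

Nothing is assumed about the higher correlators, about covariance of the limit, or about the form of
`ρ`: scale covariance of `S₂` with some `Δ` and the regular variation `ρ(cδ)/ρ(δ) → c^{-Δ}` are automatic
(file XII), the window `1/2 ≤ Δ ≤ 1` follows from the two-point bounds (file XIII), the kernel
`K(y) = S₂(0, y)` is continuous, nine-mirror invariant and nine-mirror reflection positive (file XI,
FILS 1978 passed to the limit), so it is `O(3)`-invariant by the tree's nine-mirror RP rigidity
(`HRP2Rigidity_of`, route HyperoctahedralRP); the lattice-to-continuum transfer is the pair-data ratio
theorem `tendsto_ratio_of_pairLimit` (file VIII). The hypothesis is implied by both earlier upstreams of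
the item — the shared existence crux `ExistsScaleCovariantLimit` (item 1981; `pairLimit_of_existsScaleCovariantLimit`)
and the isotropic power law `IsingEuclidUpgradeR2RotInvPowerLaw` (item 0634; `pairLimit_of_rotInvPowerLaw`) —
so this is the weakest of the three conditional forms of the milestone; the unconditional statement
stays open (Duminil-Copin, ICM 2022, §8.1).

References: H. Duminil-Copin, ICM 2022, §8.1, §8.4 [DuminilCopinICM2022]; J. Fröhlich, R. Israel,
E. H. Lieb, B. Simon, Comm. Math. Phys. 62 (1978), §3 [FrohlichEtAl1978]. No definitions are introduced.
-/

noncomputable section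

namespace Summit.CriticalPhenomena.Ising3DConformalLimit.HarmonicMomentsIsotropyTwoPoint

open Literature.Probability.LatticeModels Filter Set
open scoped Topology
open Summit.CriticalPhenomena.Ising3DConformalLimit.HyperoctahedralRPTwoPoint
open Summit.CriticalPhenomena.Ising3DConformalLimit.Theses.HarmonicMomentsIsotropy
open Summit.CriticalPhenomena.Ising3DConformalLimit.Theorems.MoebiusLimitOfTwoPointLaw.Negative
  (tendstoLocallyUniformlyOn_arity_two_of_twoPointLaw)
open Literature.Barriers.CriticalPhenomena.ScaleNotMoebius (twoPt twoPt_pos)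

/-! ### The pair-only conditional milestone -/

/-- **Existence of the two-point scaling limit gives the milestone.** If for some renormalisation
`ρ > 0` on `(0,1]` the rescaled critical pair correlator of the nearest-neighbour Ising model on `ℤ³`
converges locally uniformly off the diagonal to a function positive there, then the critical two-point
function is asymptotically `O(3)`-invariant in the vague sense (`TwoPointAsymptoticIsotropy`, item
stmt-CriticalPhenomena-6036). Proof: normalise `S₂` to vanish on the diagonal; automatic scale covariance
and regular variation (`exists_rpow_scale_and_ratio₂`), the window (`pair_window₂`), continuity and
nine-mirror invariance / reflection positivity of the kernel (`kernel_continuousOn₂`, `kernel_nineMirror₂`),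
nine-mirror RP rigidity (`HRP2Rigidity_of`) for the `O(3)`-invariance of the kernel, and the ratio theorem
from pair data (`tendsto_ratio_of_pairLimit`) applied to the family equal to `S₂` in arity `2` and `0`
elsewhere. [cite: DuminilCopinICM2022, §8.1] -/
theorem twoPointAsymptoticIsotropy_of_pairLimit
    (h : ∃ (ρ : ℝ → ℝ) (S2 : (Fin 2 → EuclideanSpace ℝ (Fin 3)) → ℝ),
      (∀ δ ∈ Set.Ioc (0:ℝ) 1, 0 < ρ δ) ∧
      TendstoLocallyUniformlyOn (rescaledCorrelator (criticalCorr 3) ρ 2) S2 (𝓝[>] (0:ℝ))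
        (NonCoincident 3 2) ∧
      ∀ z ∈ NonCoincident 3 2, 0 < S2 z) :
    TwoPointAsymptoticIsotropy := by
  classical
  obtain ⟨ρ, S2, hρ, hlim2, hnd2⟩ := h
  -- normalise the pair limit off `NonCoincident`
  set S2' : (Fin 2 → EuclideanSpace ℝ (Fin 3)) → ℝ :=
    fun z => if z ∈ NonCoincident 3 2 then S2 z else 0 with hS2'
  have S2'_in : ∀ {z}, z ∈ NonCoincident 3 2 → S2' z = S2 z := fun hz => by
    simp only [hS2', if_pos hz]
  have S2'_out : ∀ {z}, z ∉ NonCoincident 3 2 → S2' z = 0 := fun hz => by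
    simp only [hS2', if_neg hz]
  have hlim2' : TendstoLocallyUniformlyOn (rescaledCorrelator (criticalCorr 3) ρ 2) S2' (𝓝[>] (0:ℝ))
      (NonCoincident 3 2) := hlim2.congr_right fun z hz => (S2'_in hz).symm
  have hnd2' : ∀ z ∈ NonCoincident 3 2, 0 < S2' z := fun z hz => by rw [S2'_in hz]; exact hnd2 z hz
  -- automatic scale covariance, regular variation, window
  obtain ⟨Δ, -, hcov, hratio⟩ := exists_rpow_scale_and_ratio₂ hρ hlim2' hnd2'
  have hs₁ : 0 < S2' ![0, EuclideanSpace.single (0 : Fin 3) ((1 : ℕ) : ℝ)] :=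
    hnd2' _ (zero_unitVec_mem_nonCoincident (by norm_num))
  have hΔ : 1 / 2 ≤ Δ ∧ Δ ≤ 1 := pair_window₂ hρ hlim2' hs₁ (hratio 2⁻¹ (by norm_num))
  -- the auxiliary family: `S₂'` in arity `2`, `0` otherwise
  set S : CorrFamily 3 := fun n z =>
    if hn : n = 2 then S2' (fun i => z (Fin.cast hn.symm i)) else 0 with hSdef
  have hS2 : ∀ z, S 2 z = S2' z := fun z => by
    simp only [hSdef, dif_pos rfl]
    rfl
  have hS2fun : S 2 = S2' := funext hS2
  have hlimS : TendstoLocallyUniformlyOn (rescaledCorrelator (criticalCorr 3) ρ 2) (S 2) (𝓝[>] (0:ℝ))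
      (NonCoincident 3 2) := by rw [hS2fun]; exact hlim2'
  have hsc : IsScaleCovariant Δ S := by
    intro n c hc z
    by_cases hn : n = 2
    · subst hn
      rw [hS2 (fun i => c • z i), hS2 z]
      by_cases hz : z ∈ NonCoincident 3 2
      · rw [hcov c hc z hz]
        norm_num
      · have hz' : (fun i => c • z i) ∉ NonCoincident 3 2 := fun h =>
          hz (((smul_right_injective (EuclideanSpace ℝ (Fin 3)) hc.ne').of_comp_iff z).1 h)
        rw [S2'_out hz', S2'_out hz, mul_zero]
    · simp only [hSdef, dif_neg hn, mul_zero]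
  -- the kernel: continuity, positivity, homogeneity, nine mirrors, hence `O(3)`-invariance
  have hKcont : ContinuousOn (fun y : EuclideanSpace ℝ (Fin 3) => S 2 ![0, y]) {0}ᶜ := by
    rw [hS2fun]; exact kernel_continuousOn₂ hlim2'
  have hKpos : ∀ y : EuclideanSpace ℝ (Fin 3), y ≠ 0 → 0 < S 2 ![0, y] := fun y hy => by
    rw [hS2]; exact hnd2' _ (zero_pair_mem_nonCoincident hy)
  have hKhom : ∀ c : ℝ, 0 < c → ∀ y : EuclideanSpace ℝ (Fin 3),
      S 2 ![0, c • y] = c ^ (-(2 * Δ)) * S 2 ![0, y] := by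
    intro c hc y
    have h := hsc 2 c hc ![0, y]
    rw [comp_zeroPair (smul_zero c) y] at h
    rw [h]
    norm_num
  have hKmir := fun (n : EuclideanSpace ℝ (Fin 3)) (hn : ∃ i j : Fin 3, i ≠ j ∧
      (n = EuclideanSpace.single i 1 ∨ n = EuclideanSpace.single i 1 + EuclideanSpace.single j 1 ∨
        n = EuclideanSpace.single i 1 - EuclideanSpace.single j 1)) =>
    kernel_nineMirror₂ hlimS hn
  have hKrot : ∀ (T : EuclideanSpace ℝ (Fin 3) ≃ₗᵢ[ℝ] EuclideanSpace ℝ (Fin 3))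
      (y : EuclideanSpace ℝ (Fin 3)), S 2 ![0, T y] = S 2 ![0, y] :=
    Summit.CriticalPhenomena.Ising3DConformalLimit.Cruxes.HRP2Rigidity.XRayMellin.HRP2Rigidity_of Δ
      (fun y => S 2 ![0, y]) hΔ.1 hΔ.2 hKcont hKpos hKhom hKmir
  -- the test function and the rotation
  intro φ hφc hφs hφ0 hφpos R
  obtain ⟨T, hT⟩ := exists_linearIsometryEquiv_of_orthogonal R
  set φE : EuclideanSpace ℝ (Fin 3) → ℝ := fun y => φ y.ofLp with hφE
  have hφEc : Continuous φE := hφc.comp (PiLp.continuous_ofLp 2 _)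
  obtain ⟨B, hB⟩ : ∃ B, ∀ y, |φE y| ≤ B := by
    obtain ⟨C, hC⟩ := hφc.bounded_above_of_compact_support hφs
    exact ⟨C, fun y => by rw [← Real.norm_eq_abs]; exact hC _⟩
  obtain ⟨M₀, hM₀⟩ : ∃ M₀ : ℝ, ∀ v : Fin 3 → ℝ, M₀ < ‖v‖ → φ v = 0 := by
    obtain ⟨C, hC⟩ := hφs.isCompact.isBounded.exists_norm_le
    refine ⟨C, fun v hv => image_eq_zero_of_notMem_tsupport fun hmem => ?_⟩
    exact absurd (hC v hmem) (not_le.2 hv)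
  have hφEM : ∀ y : EuclideanSpace ℝ (Fin 3), 2 * M₀ < ‖y‖ → φE y = 0 := by
    intro y hy
    refine hM₀ _ ?_
    have := norm_le_two_mul_norm_ofLp y
    linarith
  have hφE0 : ∀ y, 0 ≤ φE y := fun y => hφ0 _
  have hφEpos : ∃ y, 0 < φE y := by
    obtain ⟨v, hv⟩ := hφpos
    exact ⟨WithLp.toLp 2 v, by simpa [hφE] using hv⟩
  have hmain := tendsto_ratio_of_pairLimit hρ hlimS hsc hΔ.2 hKcont hKpos (hKrot T) hφEc hB hφEM
    hφE0 hφEpos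
  -- identify the sums
  refine hmain.congr fun L => ?_
  have h1 : ∀ x : Site 3, φE (T (L⁻¹ • siteVec x)) =
      φ (L⁻¹ • (R.1.mulVec fun i => (x i : ℝ))) := by
    intro x
    simp only [hφE, hT, WithLp.ofLp_smul, Matrix.mulVec_smul]
    rfl
  have h2 : ∀ x : Site 3, φE (L⁻¹ • siteVec x) = φ (L⁻¹ • fun i => (x i : ℝ)) := by
    intro x
    simp only [hφE, WithLp.ofLp_smul]
    rfl
  simp only [h1, h2]

/-! ### Non-triviality at one pair suffices -/

/-- A pair limit is non-negative on non-coincident pairs (Griffiths' first inequality in the limit).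
[folklore] -/
theorem pair_nonneg₂ {ρ : ℝ → ℝ} {S2 : (Fin 2 → EuclideanSpace ℝ (Fin 3)) → ℝ}
    (hlim2 : TendstoLocallyUniformlyOn (rescaledCorrelator (criticalCorr 3) ρ 2) S2 (𝓝[>] (0:ℝ))
      (NonCoincident 3 2)) :
    ∀ z ∈ NonCoincident 3 2, 0 ≤ S2 z := fun z hz =>
  ge_of_tendsto (hlim2.tendsto_at hz) (Eventually.of_forall fun δ => by
    rw [rescaledCorrelator_apply, latticeApprox_comp_two, criticalCorr_two_pair]
    exact mul_nonneg (sq_nonneg _) (criticalTwoPoint_nonneg' _))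

/-- **Positivity at one pair propagates to all pairs** (pair-only form of the tree's
`isNondegenerateTwoPoint_of_two_pos`): inward by MMS in the limit (`two_le_two_of_mul_norm_lt₂`), outward
through the contracted limit `x ↦ S₂(μx)` (`tendstoLocallyUniformlyOn_comp_smul_arity`), which is a limit
of the same lattice family and hence a constant multiple of `S₂` (`exists_scale₂`).
[cite: MessagerMiracleSoleJSP1977, Theorem (monotonicity)] -/
theorem pair_pos_of_pos₂ {ρ : ℝ → ℝ} {S2 : (Fin 2 → EuclideanSpace ℝ (Fin 3)) → ℝ}
    (hρ : ∀ δ ∈ Set.Ioc (0:ℝ) 1, 0 < ρ δ)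
    (hlim2 : TendstoLocallyUniformlyOn (rescaledCorrelator (criticalCorr 3) ρ 2) S2 (𝓝[>] (0:ℝ))
      (NonCoincident 3 2))
    {x₀ : Fin 2 → EuclideanSpace ℝ (Fin 3)} (hx₀ : x₀ ∈ NonCoincident 3 2) (hpos : 0 < S2 x₀) :
    ∀ y ∈ NonCoincident 3 2, 0 < S2 y := by
  intro y hy
  have hinj₀ : Function.Injective x₀ := hx₀
  set r₀ : ℝ := ‖WithLp.ofLp (x₀ 0) - WithLp.ofLp (x₀ 1)‖ with hr₀
  set R : ℝ := ‖WithLp.ofLp (y 0) - WithLp.ofLp (y 1)‖ with hR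
  have hr₀pos : 0 < r₀ := by
    rw [hr₀, norm_pos_iff, sub_ne_zero]
    intro h
    exact absurd (hinj₀ ((WithLp.ofLp_injective 2) h)) (by decide)
  have hR0 : 0 ≤ R := norm_nonneg _
  -- inward positivity from `x₀`
  have inward : ∀ x ∈ NonCoincident 3 2,
      (3:ℝ) * ‖WithLp.ofLp (x 0) - WithLp.ofLp (x 1)‖ < r₀ → 0 < S2 x :=
    fun x hx hfar => hpos.trans_le (two_le_two_of_mul_norm_lt₂ hlim2 hx hx₀ hfar)
  -- the contraction factor
  set μ : ℝ := r₀ / (3 * R + 3 * r₀ + r₀) with hμ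
  have hden : 0 < (3:ℝ) * R + 3 * r₀ + r₀ := by positivity
  have hμ0 : 0 < μ := div_pos hr₀pos hden
  have hμ1 : μ ≤ 1 := by
    rw [hμ, div_le_one hden]
    nlinarith
  have hμR : (3:ℝ) * (μ * R) < r₀ := by
    have : (3:ℝ) * (μ * R) = r₀ * (3 * R) / (3 * R + 3 * r₀ + r₀) := by rw [hμ]; ring
    rw [this, div_lt_iff₀ hden]
    nlinarith [mul_pos hr₀pos hr₀pos]
  have hμr : (3:ℝ) * (μ * r₀) < r₀ := by
    have : (3:ℝ) * (μ * r₀) = r₀ * (3 * r₀) / (3 * R + 3 * r₀ + r₀) := by rw [hμ]; ring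
    rw [this, div_lt_iff₀ hden]
    nlinarith [mul_nonneg hr₀pos.le hR0, mul_pos hr₀pos hr₀pos]
  -- the contracted limit; its renormalisation is positive on `(0,1]`
  have hlimμ := tendstoLocallyUniformlyOn_comp_smul_arity hlim2 hμ0
  have hρμ : ∀ δ ∈ Set.Ioc (0:ℝ) 1, 0 < ρ (μ * δ) := fun δ hδ =>
    hρ _ ⟨mul_pos hμ0 hδ.1, mul_le_one₀ hμ1 hδ.1.le hδ.2⟩
  have hposμ : 0 < S2 (fun i => μ • x₀ i) := by
    refine inward _ (smul_mem_nonCoincident hμ0.ne' hx₀) ?_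
    rw [norm_ofLp_smul_sub hμ0.le]
    exact hμr
  obtain ⟨c, hc, hscale, -⟩ := exists_scale₂ hρ hρμ hlim2 hlimμ hx₀ hpos hposμ
  have hy' : 0 < S2 (fun i => μ • y i) := by
    refine inward _ (smul_mem_nonCoincident hμ0.ne' hy) ?_
    rw [norm_ofLp_smul_sub hμ0.le]
    exact hμR
  have heq : S2 (fun i => μ • y i) = c ^ 2 * S2 y := hscale y hy
  rw [heq] at hy'
  exact pos_of_mul_pos_right hy' (pow_pos hc 2).le

/-- **A non-trivial two-point scaling limit gives the milestone**: in
`twoPointAsymptoticIsotropy_of_pairLimit` it suffices that the pair limit be non-zero at ONE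
non-coincident pair (`pair_nonneg₂`, `pair_pos_of_pos₂`). [cite: DuminilCopinICM2022, §8.1] -/
theorem twoPointAsymptoticIsotropy_of_nontrivialPairLimit
    (h : ∃ (ρ : ℝ → ℝ) (S2 : (Fin 2 → EuclideanSpace ℝ (Fin 3)) → ℝ),
      (∀ δ ∈ Set.Ioc (0:ℝ) 1, 0 < ρ δ) ∧
      TendstoLocallyUniformlyOn (rescaledCorrelator (criticalCorr 3) ρ 2) S2 (𝓝[>] (0:ℝ))
        (NonCoincident 3 2) ∧
      ∃ z ∈ NonCoincident 3 2, S2 z ≠ 0) :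
    TwoPointAsymptoticIsotropy := by
  obtain ⟨ρ, S2, hρ, hlim2, z, hz, hz0⟩ := h
  have hzpos : 0 < S2 z := lt_of_le_of_ne (pair_nonneg₂ hlim2 z hz) (Ne.symm hz0)
  exact twoPointAsymptoticIsotropy_of_pairLimit ⟨ρ, S2, hρ, hlim2, pair_pos_of_pos₂ hρ hlim2 hz hzpos⟩

/-! ### The pair hypothesis is the common weakening of the two earlier upstreams -/

/-- The shared existence crux `ExistsScaleCovariantLimit` (item stmt-CriticalPhenomena-1981) gives the
pair hypothesis (its arity-`2` instance). [cite: DuminilCopinICM2022, §8.4] -/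
theorem pairLimit_of_existsScaleCovariantLimit (hEX : ExistsScaleCovariantLimit) :
    ∃ (ρ : ℝ → ℝ) (S2 : (Fin 2 → EuclideanSpace ℝ (Fin 3)) → ℝ),
      (∀ δ ∈ Set.Ioc (0:ℝ) 1, 0 < ρ δ) ∧
      TendstoLocallyUniformlyOn (rescaledCorrelator (criticalCorr 3) ρ 2) S2 (𝓝[>] (0:ℝ))
        (NonCoincident 3 2) ∧
      ∀ z ∈ NonCoincident 3 2, 0 < S2 z := by
  obtain ⟨ρ, _, S, hρ, _, hlim, _, hnd, _, _⟩ := hEX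
  exact ⟨ρ, S 2, hρ, hlim 2, hnd⟩

/-- The isotropic power law `IsingEuclidUpgradeR2RotInvPowerLaw` (item stmt-CriticalPhenomena-0634) gives
the pair hypothesis, with `ρ(δ) = δ^{-Δ}` and `S₂(a,b) = c‖a − b‖^{-2Δ}`
(`tendstoLocallyUniformlyOn_arity_two_of_twoPointLaw`). [cite: DuminilCopinICM2022, §8.1] -/
theorem pairLimit_of_rotInvPowerLaw (hP : Theses.IsingEuclidUpgrade.IsingEuclidUpgradeR2RotInvPowerLaw) :
    ∃ (ρ : ℝ → ℝ) (S2 : (Fin 2 → EuclideanSpace ℝ (Fin 3)) → ℝ),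
      (∀ δ ∈ Set.Ioc (0:ℝ) 1, 0 < ρ δ) ∧
      TendstoLocallyUniformlyOn (rescaledCorrelator (criticalCorr 3) ρ 2) S2 (𝓝[>] (0:ℝ))
        (NonCoincident 3 2) ∧
      ∀ z ∈ NonCoincident 3 2, 0 < S2 z := by
  obtain ⟨Δ, c, hc, hPt⟩ := hP
  refine ⟨fun δ => δ ^ (-Δ), fun z => c * twoPt Δ (z 0) (z 1), fun δ hδ => Real.rpow_pos_of_pos hδ.1 _,
    tendstoLocallyUniformlyOn_arity_two_of_twoPointLaw hc hPt, fun z hz => ?_⟩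
  have hinj : Function.Injective z := hz
  exact mul_pos hc (twoPt_pos Δ fun h => absurd (hinj h) (by decide))

end Summit.CriticalPhenomena.Ising3DConformalLimit.HarmonicMomentsIsotropyTwoPoint

end
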